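import Mathlib
import Summits.Ventures.PercRepro2.Defs
import Summits.Ventures.PercRepro2.Graph
import Summits.Ventures.PercRepro2.OneColourSwitch
import Summits.Ventures.PercRepro2.RegionHubSign
import Summits.Ventures.PercRepro2.SideSwitch
import Summits.Ventures.PercRepro2.SideSwitchFibre
import Summits.Ventures.PercRepro2.SideSwitchMono
import Summits.Ventures.PercRepro2.SideSwitchM9
import Summits.Ventures.PercRepro2.SideSwitchClosed
import Summits.Ventures.PercRepro2.SideSwitchComps
import Summits.Ventures.PercRepro2.TermSwitchDefs
import Summits.Ventures.PercRepro2.TermSwitchFibre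
import Summits.Ventures.PercRepro2.TermSwitchCompsFibre
import Summits.Ventures.PercRepro2.TermSwitchMono
import Summits.Ventures.PercRepro2.TermSwitchM9
import Summits.Ventures.PercRepro2.TermSwitchRestrict

/-!
# The half-cube theorem: a pair prefers `W` on the class where a given vertex is `Y`-reached from
the terminal set (blind cell PercRepro2, p3 g38, 2026-08-29; `proofs/P3-POCKETRK.md` §8‴)

For a terminal set `H`, marks `p, q` and a fibre-invariant predicate `P`, the terminal-set sum
restricted to the colourings in which a given vertex `x₀` lies in the `Y`-world of `H` is
non-positive WITHOUT any `σ_rs` factor: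
`Σ_{ω ∈ Sep_H ∩ DZero_H, P ω, x₀ ∈ K_H(ω)} σ_pq(ω) ≤ 0` (`dzeroSigmaSumHP_KH_nonpos`; the sum is
stated inline, no new definition).

Proof.  Fibre by fibre (`sum_dzeroH_eq_sum_repH_comps`, doubled by the outside flip as in
`TermSwitchRestrict`): for a representative `ρ` the condition `x₀ ∈ K_H(ρ_T)` is constant
(`x₀ ∈ H`, the full fibre: `Σ_T (G T − G (A ∖ T)) = 0`), empty (`x₀ ∉ K_H ρ`), or «the
component `C` of `x₀` is not switched» — a HALF-CUBE `{T ⊆ A ∖ {C}}`, on which the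
per-representative identity `σ_pq(ρ_T) + σ_pq(ρ^O_T) = G T − G (A ∖ T)`
(`sigma_pq_add_flipOH_C`) and the reindexing `T ↦ (A ∖ {C}) ∖ T` give
`Σ_{T ⊆ A ∖ {C}} (G T − G (insert C T)) ≤ 0` by the monotonicity of `p ~_Y q` in the
`W`-side set (`conn_pq_assignC_mono_H`): `halfcube_sum_nonpos`.  No Harris is needed — the
half-cube inequality is termwise.  Own work; std axioms.
-/

namespace Summit.Ventures.PercRepro2

namespace TermSwitch

open Finset Classical RegionHub OneColourSwitch SideSwitch

variable {V : Type*} {E : Type*}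

section Count

variable [Fintype V] [DecidableEq V] [Fintype E] [DecidableEq E]

variable {ends : E → Sym2 V}

omit [Fintype E] [DecidableEq E] in
/-- The component assignment of the outside-flipped representative is the outside flip of the
component assignment. -/
lemma assignC_flipOH_eq_H {H : Set V} {ρ : Config E} {T : Finset (Finset V)}
    (hT : T ⊆ compsH ends H ρ) :
    assignC ends T (flipOH ends H ρ) =
      flipIn ends (OsetH ends H (assignC ends T ρ)) (assignC ends T ρ) := by
  rw [OsetH_assignC hT]
  simp only [flipOH, assignC, assign]
  exact (flipIn_flipTouch _ _ _).symm

omit [Fintype E] [DecidableEq E] in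
/-- The `Y`-world of `H` is the same for the component assignment of a representative and of
its outside flip. -/
lemma KH_assignC_flipOH {H : Set V} {ρ : Config E} {T : Finset (Finset V)}
    (hT : T ⊆ compsH ends H ρ) :
    KH ends H (assignC ends T (flipOH ends H ρ)) = KH ends H (assignC ends T ρ) := by
  rw [assignC_flipOH_eq_H hT, KH_flipIn_OsetH]

/-- The `Y`-world of `H` after a component assignment of a representative: the switched
components leave it. -/
lemma KH_assignC_of_mem_RepH {p q : V} {H : Set V} {ρ : Config E}
    (hρ : ρ ∈ RepH ends p q H) {T : Finset (Finset V)} (hT : T ⊆ compsH ends H ρ) :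
    KH ends H (assignC ends T ρ) = KH ends H ρ \ (↑(unionT T) : Set V) := by
  obtain ⟨_, h2, h3⟩ := switch_data_unionT_H hT
  simp only [assignC, assign]
  rw [KH_flipTouch_of_closed h2 h3]
  have hM : (↑(unionT T) : Set V) ∩ MH ends H ρ = ∅ := by
    ext x
    simp only [Set.mem_inter_iff, Finset.mem_coe, Set.mem_empty_iff_false, iff_false, not_and]
    intro hx hxM
    exact h2 x (Finset.mem_coe.2 hx) ((mem_RepH.1 hρ).2 x hxM)
  rw [hM, Set.union_empty]

omit [Fintype E] [DecidableEq E] in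
/-- A vertex of a union of components lies in exactly its own component: `x₀ ∈ ⋃ T` iff the
component of `x₀` belongs to `T`. -/
lemma mem_unionT_iff_compIn_mem {H : Set V} {ρ : Config E} {T : Finset (Finset V)}
    (hT : T ⊆ compsH ends H ρ) (x₀ : V) :
    x₀ ∈ unionT T ↔ compIn ends (↑(A0H ends H ρ) : Set V) x₀ ∈ T := by
  constructor
  · intro h
    obtain ⟨C, hC, hxC⟩ := mem_unionT.1 h
    rw [← eq_compIn_of_mem_compsH (hT hC) hxC]
    exact hC
  · intro h
    exact mem_unionT.2 ⟨_, h, mem_compIn_self _ _⟩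

omit [Fintype V] in
/-- The powerset of `A` with the member `C` excluded is the powerset of `A.erase C`. -/
lemma filter_powerset_notMem (A : Finset (Finset V)) (C : Finset V) :
    A.powerset.filter (fun T => C ∉ T) = (A.erase C).powerset := by
  ext T
  simp only [Finset.mem_filter, Finset.mem_powerset, Finset.subset_erase]

/-- **The half-cube inequality**: for a representative `ρ` and a component `C` of its sided set,
`Σ_{T ⊆ compsH ρ ∖ {C}} (σ_pq(ρ_T) + σ_pq(ρ^O_T)) ≤ 0`. -/
theorem halfcube_sum_nonpos {p q : V} {H : Set V} {ρ : Config E} (hρ : ρ ∈ RepH ends p q H)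
    {C : Finset V} (hC : C ∈ compsH ends H ρ) :
    ∑ T ∈ ((compsH ends H ρ).erase C).powerset,
      (sigma ends (assignC ends T ρ) p q +
        sigma ends (assignC ends T (flipOH ends H ρ)) p q) ≤ 0 := by
  set A := compsH ends H ρ with hA
  set A' := A.erase C with hA'
  have hA'A : A' ⊆ A := Finset.erase_subset C A
  let G : Finset (Finset V) → ℤ := fun T =>
    (if Conn ends (assignC ends T ρ) p q then (1 : ℤ) else 0) +
      (if Conn ends (assignC ends T (flipOH ends H ρ)) p q then 1 else 0)
  have hρO := flipOH_mem_RepH hρ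
  have hmonoG : ∀ T T', T ⊆ T' → T' ⊆ A → G T ≤ G T' := by
    intro T T' hTT hT'
    have hT'O : T' ⊆ compsH ends H (flipOH ends H ρ) := by rw [compsH_flipOH]; exact hT'
    exact add_le_add (ite_le_ite_of_imp (conn_pq_assignC_mono_H hρ hTT hT'))
      (ite_le_ite_of_imp (conn_pq_assignC_mono_H hρO hTT hT'O))
  -- the summand is `G T − G (A ∖ T)`
  have hterm : ∀ T ∈ A'.powerset,
      sigma ends (assignC ends T ρ) p q + sigma ends (assignC ends T (flipOH ends H ρ)) p q =
        G T - G (A \ T) := by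
    intro T hT
    exact sigma_pq_add_flipOH_C hρ ((Finset.mem_powerset.1 hT).trans hA'A)
  rw [Finset.sum_congr rfl hterm, Finset.sum_sub_distrib]
  -- `A ∖ T = insert C (A' ∖ T)` for `T ⊆ A'`
  have hcompl : ∀ T ∈ A'.powerset, A \ T = insert C (A' \ T) := by
    intro T hT
    have hTA' : T ⊆ A' := Finset.mem_powerset.1 hT
    have hCT : C ∉ T := fun h => Finset.notMem_erase C A (hTA' h)
    ext D
    simp only [Finset.mem_sdiff, Finset.mem_insert, hA', Finset.mem_erase]
    constructor
    · rintro ⟨hDA, hDT⟩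
      by_cases hDC : D = C
      · exact Or.inl hDC
      · exact Or.inr ⟨⟨hDC, hDA⟩, hDT⟩
    · rintro (rfl | ⟨⟨_, hDA⟩, hDT⟩)
      · exact ⟨hC, hCT⟩
      · exact ⟨hDA, hDT⟩
  have hre : ∑ T ∈ A'.powerset, G (A \ T) = ∑ T ∈ A'.powerset, G (insert C T) := by
    rw [Finset.sum_congr rfl (fun T hT => by rw [hcompl T hT])]
    exact sum_powerset_sdiff A' (fun T => G (insert C T))
  rw [hre, ← Finset.sum_sub_distrib]
  refine Finset.sum_nonpos (fun T hT => ?_)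
  have hTA' : T ⊆ A' := Finset.mem_powerset.1 hT
  have h1 : T ⊆ insert C T := Finset.subset_insert C T
  have h2 : insert C T ⊆ A := Finset.insert_subset hC (hTA'.trans hA'A)
  have := hmonoG T (insert C T) h1 h2
  linarith

/-- The full-cube sum of the per-representative identity vanishes:
`Σ_{T ⊆ compsH ρ} (σ_pq(ρ_T) + σ_pq(ρ^O_T)) = 0`. -/
lemma fullcube_sum_eq_zero {p q : V} {H : Set V} {ρ : Config E} (hρ : ρ ∈ RepH ends p q H) :
    ∑ T ∈ (compsH ends H ρ).powerset,
      (sigma ends (assignC ends T ρ) p q +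
        sigma ends (assignC ends T (flipOH ends H ρ)) p q) = 0 := by
  set A := compsH ends H ρ with hA
  let G : Finset (Finset V) → ℤ := fun T =>
    (if Conn ends (assignC ends T ρ) p q then (1 : ℤ) else 0) +
      (if Conn ends (assignC ends T (flipOH ends H ρ)) p q then 1 else 0)
  have hterm : ∀ T ∈ A.powerset,
      sigma ends (assignC ends T ρ) p q + sigma ends (assignC ends T (flipOH ends H ρ)) p q =
        G T - G (A \ T) := by
    intro T hT
    exact sigma_pq_add_flipOH_C hρ (Finset.mem_powerset.1 hT)
  rw [Finset.sum_congr rfl hterm, Finset.sum_sub_distrib, sum_powerset_sdiff, sub_self]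

/-- The per-representative half-cube sum with the condition «`x₀ ∈ K_H(ρ_T)`» is non-positive. -/
lemma fibre_KH_sum_nonpos {p q : V} {H : Set V} {ρ : Config E} (hρ : ρ ∈ RepH ends p q H)
    (x₀ : V) :
    ∑ T ∈ (compsH ends H ρ).powerset,
      (if x₀ ∈ KH ends H (assignC ends T ρ) then
        sigma ends (assignC ends T ρ) p q +
          sigma ends (assignC ends T (flipOH ends H ρ)) p q else 0) ≤ 0 := by
  set A := compsH ends H ρ with hA
  by_cases hx₀ : x₀ ∈ KH ends H ρ
  · by_cases hxH : x₀ ∈ H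
    · -- the full cube: the condition holds for every `T`
      have hall : ∀ T ∈ A.powerset, x₀ ∈ KH ends H (assignC ends T ρ) := fun T _ =>
        mem_KH_of_mem hxH _
      rw [Finset.sum_congr rfl (fun T hT => if_pos (hall T hT)), fullcube_sum_eq_zero hρ]
    · -- the half cube of the component of `x₀`
      have hxA : x₀ ∈ A0H ends H ρ := mem_A0H.2 ⟨Or.inl hx₀, hxH⟩
      set C := compIn ends (↑(A0H ends H ρ) : Set V) x₀ with hCdef
      have hC : C ∈ A := Finset.mem_image.2 ⟨x₀, hxA, rfl⟩
      have hcond : ∀ T ∈ A.powerset, (x₀ ∈ KH ends H (assignC ends T ρ) ↔ C ∉ T) := by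
        intro T hT
        have hTA : T ⊆ A := Finset.mem_powerset.1 hT
        rw [KH_assignC_of_mem_RepH hρ hTA, Set.mem_sdiff, Finset.mem_coe,
          mem_unionT_iff_compIn_mem hTA x₀]
        exact ⟨fun h => h.2, fun h => ⟨hx₀, h⟩⟩
      rw [Finset.sum_congr rfl (fun T hT => by rw [if_congr (hcond T hT) rfl rfl]),
        ← Finset.sum_filter, filter_powerset_notMem]
      exact halfcube_sum_nonpos hρ hC
  · -- empty: `x₀` is never in the `Y`-world along the fibre
    have hnone : ∀ T ∈ A.powerset, x₀ ∉ KH ends H (assignC ends T ρ) := by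
      intro T hT h
      rw [KH_assignC_of_mem_RepH hρ (Finset.mem_powerset.1 hT)] at h
      exact hx₀ h.1
    rw [Finset.sum_congr rfl (fun T hT => if_neg (hnone T hT))]
    simp

/-- **The half-cube theorem**: for a fibre-invariant predicate `P` and any vertex `x₀`,
`Σ_{ω ∈ Sep_H ∩ DZero_H, P ω, x₀ ∈ K_H(ω)} σ_pq(ω) ≤ 0` — the pair `p, q` prefers `W` on the
class where `x₀` is `Y`-reached from the terminal set. -/
theorem dzeroSigmaSumHP_KH_nonpos (p q : V) (H : Set V) (P : Config E → Prop)
    (hPa : ∀ ρ ∈ RepH ends p q H, ∀ T ⊆ compsH ends H ρ, (P (assignC ends T ρ) ↔ P ρ))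
    (hPO : ∀ ρ ∈ RepH ends p q H, (P (flipOH ends H ρ) ↔ P ρ)) (x₀ : V) :
    (∑ ω : Config E, if sepH ends p q H ω ∧ DZeroH ends H ω ∧ P ω ∧ x₀ ∈ KH ends H ω then
      sigma ends ω p q else 0) ≤ 0 := by
  set S₀ : ℤ := ∑ ω : Config E, if sepH ends p q H ω ∧ DZeroH ends H ω ∧ P ω ∧
    x₀ ∈ KH ends H ω then sigma ends ω p q else 0 with hS₀
  -- the fibration, with `P` pulled out of the inner sum
  have hsum : S₀ =
      ∑ ρ ∈ RepH ends p q H, if P ρ then ∑ T ∈ (compsH ends H ρ).powerset,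
        (if x₀ ∈ KH ends H (assignC ends T ρ) then sigma ends (assignC ends T ρ) p q else 0)
      else 0 := by
    have h1 : S₀ =
        ∑ ω ∈ DZeroSetH ends p q H,
          if P ω ∧ x₀ ∈ KH ends H ω then sigma ends ω p q else 0 := by
      have hset : DZeroSetH ends p q H =
          univ.filter (fun ω => sepH ends p q H ω ∧ DZeroH ends H ω) := by
        ext ω; simp [DZeroSetH, SepSetH]
      rw [hset, Finset.sum_filter, hS₀]
      refine Finset.sum_congr rfl (fun ω _ => ?_)
      by_cases h1 : sepH ends p q H ω ∧ DZeroH ends H ω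
      · by_cases h2 : P ω ∧ x₀ ∈ KH ends H ω
        · rw [if_pos ⟨h1.1, h1.2, h2.1, h2.2⟩, if_pos h1, if_pos h2]
        · rw [if_neg (fun h => h2 ⟨h.2.2.1, h.2.2.2⟩), if_pos h1, if_neg h2]
      · rw [if_neg (fun h => h1 ⟨h.1, h.2.1⟩), if_neg h1]
    rw [h1, sum_dzeroH_eq_sum_repH_comps (fun ω =>
      if P ω ∧ x₀ ∈ KH ends H ω then sigma ends ω p q else 0)]
    refine Finset.sum_congr rfl (fun ρ hρ => ?_)
    by_cases hP : P ρ
    · rw [if_pos hP]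
      refine Finset.sum_congr rfl (fun T hT => ?_)
      have hPT := (hPa ρ hρ T (Finset.mem_powerset.1 hT)).2 hP
      by_cases hK : x₀ ∈ KH ends H (assignC ends T ρ)
      · rw [if_pos ⟨hPT, hK⟩, if_pos hK]
      · rw [if_neg (fun h => hK h.2), if_neg hK]
    · rw [if_neg hP]
      refine Finset.sum_eq_zero (fun T hT => ?_)
      rw [if_neg (fun h => hP ((hPa ρ hρ T (Finset.mem_powerset.1 hT)).1 h.1))]
  -- the same sum through the outside flip of the representatives
  have hsumO : (∑ ρ ∈ RepH ends p q H, if P ρ then ∑ T ∈ (compsH ends H ρ).powerset,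
        (if x₀ ∈ KH ends H (assignC ends T ρ) then sigma ends (assignC ends T ρ) p q else 0)
      else 0) =
      ∑ ρ ∈ RepH ends p q H, if P ρ then ∑ T ∈ (compsH ends H ρ).powerset,
        (if x₀ ∈ KH ends H (assignC ends T ρ) then
          sigma ends (assignC ends T (flipOH ends H ρ)) p q else 0) else 0 := by
    symm
    refine Finset.sum_nbij' (fun ρ => flipOH ends H ρ) (fun ρ => flipOH ends H ρ)
      (fun ρ hρ => flipOH_mem_RepH hρ) (fun ρ hρ => flipOH_mem_RepH hρ)
      (fun ρ _ => flipOH_flipOH H ρ) (fun ρ _ => flipOH_flipOH H ρ) ?_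
    intro ρ hρ
    rw [compsH_flipOH]
    by_cases hP : P ρ
    · rw [if_pos hP, if_pos ((hPO ρ hρ).2 hP)]
      refine Finset.sum_congr rfl (fun T hT => ?_)
      rw [KH_assignC_flipOH (Finset.mem_powerset.1 hT)]
    · rw [if_neg hP, if_neg (fun h => hP ((hPO ρ hρ).1 h))]
  have hkey : ∀ ρ ∈ RepH ends p q H,
      (if P ρ then ∑ T ∈ (compsH ends H ρ).powerset,
        (if x₀ ∈ KH ends H (assignC ends T ρ) then
          sigma ends (assignC ends T ρ) p q +
            sigma ends (assignC ends T (flipOH ends H ρ)) p q else 0) else 0) ≤ 0 := by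
    intro ρ hρ
    by_cases hP : P ρ
    · rw [if_pos hP]; exact fibre_KH_sum_nonpos hρ x₀
    · rw [if_neg hP]
  have htwice : 2 * S₀ ≤ 0 := by
    calc 2 * S₀ = S₀ + S₀ := by ring
      _ = (∑ ρ ∈ RepH ends p q H, if P ρ then ∑ T ∈ (compsH ends H ρ).powerset,
            (if x₀ ∈ KH ends H (assignC ends T ρ) then sigma ends (assignC ends T ρ) p q
              else 0) else 0) +
          ∑ ρ ∈ RepH ends p q H, if P ρ then ∑ T ∈ (compsH ends H ρ).powerset,
            (if x₀ ∈ KH ends H (assignC ends T ρ) then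
              sigma ends (assignC ends T (flipOH ends H ρ)) p q else 0) else 0 := by
          rw [← hsumO, ← hsum]
      _ = ∑ ρ ∈ RepH ends p q H, if P ρ then ∑ T ∈ (compsH ends H ρ).powerset,
            (if x₀ ∈ KH ends H (assignC ends T ρ) then
              sigma ends (assignC ends T ρ) p q +
                sigma ends (assignC ends T (flipOH ends H ρ)) p q else 0) else 0 := by
          rw [← Finset.sum_add_distrib]
          refine Finset.sum_congr rfl (fun ρ _ => ?_)
          by_cases hP : P ρ
          · simp only [if_pos hP]
            rw [← Finset.sum_add_distrib]
            refine Finset.sum_congr rfl (fun T _ => ?_)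
            by_cases hK : x₀ ∈ KH ends H (assignC ends T ρ)
            · simp only [if_pos hK]
            · simp only [if_neg hK, add_zero]
          · simp only [if_neg hP, add_zero]
      _ ≤ 0 := Finset.sum_nonpos (fun ρ hρ => hkey ρ hρ)
  linarith

end Count

end TermSwitch

end Summit.Ventures.PercRepro2
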